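import Mathlib
import Summits.Ventures.PercRepro2.HCov
import Summits.Ventures.PercRepro2.RootLeafUPocket3Closed

/-!
# The closed boundary-`{u, a₂, c}` pocket class with the splitting maps instantiated
(blind cell PercRepro2, p4 g23; S3 (G4-u); no definitions; ref-2 g21's minor m₁₂₂ (a) on S3 v85)

`Pocket3Closed.HCov_root_leaf_u_pocket3` takes the two splitting maps `off` / `inn` of a configuration as
parameters characterised by `hoff` / `hinn`.  Here they are instantiated by the obvious if-then-else maps, so the
statement carries only the leaf structure, the pocket boundary and the (G4-u) induction hypothesis:
**`HCov_root_leaf_u_pocket3_if`**.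
-/

namespace Summit.Ventures.PercRepro2

open UnionCluster CovForm

namespace RootLeafU

namespace Pocket3Closed

variable {V : Type*} {E : Type*} [Fintype E] [DecidableEq E] [Fintype V] [DecidableEq V]
  {R : Type*} [Field R] [LinearOrder R] [IsStrictOrderedRing R] (p : E → R)
variable {ends : E → Sym2 V} {P : Set V} {o u a₂ c b : V}

/-- **(G4-u) on the whole boundary-`{u, a₂, c}` pocket class, splitting maps instantiated**: for `b` in a pocket `P`
with `o, u, a₂, c ∉ P` whose edges all end in `P ∪ {u, a₂, c}` (pairwise distinct terminals) and `a₁` pendant at `u`,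
(HCOV) at `(o, a₁, a₂, c, b)` follows from (HCOV) at `(o, u, a₂, c, b)` — every leaf weight, every weight vector. -/
theorem HCov_root_leaf_u_pocket3_if {f : E} {a₁ : V} (hf : ends f = s(a₁, u))
    (hleaf : ∀ e, a₁ ∈ ends e → e = f) (h1u : a₁ ≠ u) (h12 : a₁ ≠ a₂) (h1c : a₁ ≠ c)
    (h1o : a₁ ≠ o) (h1b : a₁ ≠ b)
    (hp : IsProbVec p) (hP : ∀ e y z, ends e = s(y, z) → y ∈ P → z ∈ P ∨ z = u ∨ z = a₂ ∨ z = c)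
    (hu : u ∉ P) (ha : a₂ ∉ P) (hc : c ∉ P) (hb : b ∈ P) (hua : u ≠ a₂) (hac : a₂ ≠ c) (huc : u ≠ c) (ho : o ∉ P)
    (h3 : HCov p ends o u a₂ c b) : HCov p ends o a₁ a₂ c b := by
  classical
  exact HCov_root_leaf_u_pocket3 p hf hleaf h1u h12 h1c h1o h1b hp hP
    (off := fun (ω : Config E) (e : E) => if e ∈ touches ends P then false else ω e)
    (inn := fun (ω : Config E) (e : E) => if e ∈ touches ends P then ω e else false)
    ⟨fun ω e he => by simp only [if_pos he], fun ω e he => by simp only [if_neg he]⟩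
    ⟨fun ω e he => by simp only [if_pos he], fun ω e he => by simp only [if_neg he]⟩
    hu ha hc hb hua hac huc ho h3

end Pocket3Closed

end RootLeafU

end Summit.Ventures.PercRepro2
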